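import Literature.NumberTheory.IwasawaTheory.LayerIwasawaInvariants
import Mathlib.NumberTheory.Padics.RingHoms
import Mathlib.RingTheory.PowerSeries.Order
import Mathlib.RingTheory.PowerSeries.Trunc
import Mathlib.Algebra.Polynomial.Div
import Mathlib.Algebra.CharP.Lemmas
import HarnessLib

/-!
# Crux `ResidualThetaMainConjectureAtTwo` (stmt-BirchSwinnertonDyer-20787), line `birth` — toolkit:
# the layer `λ`-invariant (Pollack–Weston §3.1) of an INTEGRAL polynomial is the `X`-adic order of its
# reduction mod `p`

Cell `bsd-wall`, seat `bsd-wall-rtt-p2` (LEAD PROVER, line mode), helper file for stub R2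
`stub_analyticLayerLawAtTwo` of the registered skeleton `Lines/birth.lean` of the crux. THEOREMS ONLY
(no `def`, no named fact, no `sorry`); nothing here is specific to elliptic curves.

The route decl `ResidualThetaMainConjectureAtTwo` measures Mazur–Tate layer elements through
`Literature.NumberTheory.IwasawaTheory.layerLambda θ = min {j : ‖θ_j‖ = max_i ‖θ_i‖}` (Pollack–Weston
2011 §3.1, in the `T`-basis) for `θ ∈ ℚ̄₂[X]`. Every element met in stub R2 is, up to a non-zero
constant, the image of a polynomial `P ∈ ℤ_p[X]`; for such `P` the layer `λ` is simply
`ord_X (P mod p)`: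

* `supNorm_eq_of_forall_le` — a sup-norm recogniser (`max ‖a_j‖ = s` once all `‖a_j‖ ≤ s` and one
  `‖a_k‖ = s`);
* `layerLambda_C_mul` — `λ(c·θ) = λ(θ)` for a non-zero constant `c` of a normed field;
* `layerLambda_map_eq_of_coeff` / `layerLambda_map_eq_of_order` — for `P ∈ ℤ_p[X]` whose reduction
  `P̄ ∈ 𝔽_p[X]` has `X`-order `k` (coefficients below `k` vanish mod `p`, the `k`-th does not) and any
  norm-preserving ring map `φ : ℤ_p → A`, `layerLambda (P.map φ) = k` and `supNorm (P.map φ) = 1`;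
* `X_add_one_pow_prime_pow_sub_one` — `(X + 1)^{pⁿ} − 1 = X^{pⁿ}` in `𝔽_p[X]` (so reduction modulo
  `ω_n = (1+T)^{pⁿ} − 1` is, mod `p`, truncation below degree `pⁿ`);
* `coeff_modByMonic_X_pow_of_lt`, `order_coe_modByMonic_X_pow` — truncation below `X^N` does not
  change the coefficients below `N`, hence not the `X`-order when it is `< N`;
* `val_toZModPow_eq_pow_mul` — for `0 ≠ f ∈ ℤ_p` with `v_p(f) < n`, the canonical representative
  of `f mod pⁿ` is `p^{v_p(f)} · e′` with `p ∤ e′` (used for the layer-`n` Frobenius exponent).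

References: R. Pollack, T. Weston, Duke Math. J. 156 (2011) §3.1 [PollackWeston2011MT];
L. Washington, GTM 83, §7.1 [Washington1997].
-/

set_option linter.dupNamespace false
set_option autoImplicit false

noncomputable section

open scoped Classical

open Polynomial Literature.NumberTheory.IwasawaTheory

namespace Summit.BirchSwinnertonDyer.BirchSwinnertonDyer.Theorems.ResidualThetaLayer

/-! ## §1. Sup norm and `λ` under scaling -/

section SupNorm

variable {A : Type*} [NormedRing A]

/-- Sup-norm recogniser: if every coefficient has norm `≤ s` and one has norm `= s`, the sup norm
is `s`. [cite: PollackWeston2011MT, §3.1] -/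
theorem supNorm_eq_of_forall_le (q : A[X]) {s : ℝ} (hle : ∀ i, ‖q.coeff i‖ ≤ s) {k : ℕ}
    (hk : ‖q.coeff k‖ = s) : q.supNorm = s := by
  apply le_antisymm
  · obtain ⟨i, hi⟩ := q.exists_eq_supNorm
    rw [hi]
    exact hle i
  · rw [← hk]
    exact q.le_supNorm k

end SupNorm

section Scaling

variable {K : Type*} [NormedField K]

/-- `supNorm (c · θ) = ‖c‖ · supNorm θ` over a normed field. [cite: PollackWeston2011MT, §3.1] -/
theorem supNorm_C_mul (c : K) (q : K[X]) : (C c * q).supNorm = ‖c‖ * q.supNorm := by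
  obtain ⟨i, hi⟩ := q.exists_eq_supNorm
  refine supNorm_eq_of_forall_le (C c * q) (fun j ↦ ?_) (k := i) ?_
  · rw [coeff_C_mul, norm_mul]
    exact mul_le_mul_of_nonneg_left (q.le_supNorm j) (norm_nonneg c)
  · rw [coeff_C_mul, norm_mul, hi]

/-- **`λ(c · θ) = λ(θ)`** for a non-zero constant `c` of a normed field (the set of indices at which
the maximal coefficient norm is attained is unchanged). [cite: PollackWeston2011MT, §3.1] -/
theorem layerLambda_C_mul {c : K} (hc : c ≠ 0) (q : K[X]) :
    layerLambda (C c * q) = layerLambda q := by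
  have hc' : ‖c‖ ≠ 0 := norm_ne_zero_iff.mpr hc
  rw [layerLambda_def, layerLambda_def, supNorm_C_mul]
  congr 1
  ext j
  simp only [Set.mem_setOf_eq, coeff_C_mul, norm_mul]
  exact (mul_right_injective₀ hc').eq_iff

end Scaling

/-! ## §2. Integral polynomials: `λ` is the `X`-order of the reduction mod `p` -/

section Integral

variable {p : ℕ} [hp : Fact p.Prime] {A : Type*} [NormedRing A]

/-- **Layer `λ` of an integral polynomial.** For `P ∈ ℤ_p[X]` whose coefficients below `k` vanish
mod `p` while the `k`-th does not, and any NORM-PRESERVING ring map `φ : ℤ_p → A`,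
`layerLambda (P.map φ) = k` and `supNorm (P.map φ) = 1` (Pollack–Weston: `λ = ord_{I_n}` of the
reduction, `I_n = (T)`). [cite: PollackWeston2011MT, §3.1] -/
theorem layerLambda_map_eq_of_coeff (φ : ℤ_[p] →+* A) (hφ : ∀ x, ‖φ x‖ = ‖x‖) {P : ℤ_[p][X]}
    {k : ℕ} (hlt : ∀ j < k, PadicInt.toZMod (P.coeff j) = 0) (hk : PadicInt.toZMod (P.coeff k) ≠ 0) :
    layerLambda (P.map φ) = k ∧ (P.map φ).supNorm = 1 := by
  -- the kernel of reduction mod `p` is the maximal ideal `{‖x‖ < 1}` (tree: `MordellDescent.padicInt_norm_*`)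
  have hlt1 : ∀ {x : ℤ_[p]}, PadicInt.toZMod x = 0 → ‖x‖ < 1 := fun {x} h ↦ by
    rw [← RingHom.mem_ker, PadicInt.ker_toZMod, IsLocalRing.mem_maximalIdeal, PadicInt.mem_nonunits] at h
    exact h
  have heq1 : ∀ {x : ℤ_[p]}, PadicInt.toZMod x ≠ 0 → ‖x‖ = 1 := fun {x} h ↦
    le_antisymm (PadicInt.norm_le_one x) (not_lt.mp fun hlt' ↦ h (by
      rw [← RingHom.mem_ker, PadicInt.ker_toZMod, IsLocalRing.mem_maximalIdeal, PadicInt.mem_nonunits]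
      exact hlt'))
  have hnorm : ∀ j, ‖(P.map φ).coeff j‖ = ‖P.coeff j‖ := fun j ↦ by rw [coeff_map, hφ]
  have hsup : (P.map φ).supNorm = 1 := by
    refine supNorm_eq_of_forall_le _ (fun j ↦ ?_) (k := k) ?_
    · rw [hnorm]; exact PadicInt.norm_le_one _
    · rw [hnorm]; exact heq1 hk
  refine ⟨?_, hsup⟩
  rw [layerLambda_eq_iff, hsup]
  refine ⟨by rw [hnorm]; exact heq1 hk, fun j hj ↦ ?_⟩
  rw [hnorm]
  exact hlt1 (hlt j hj)

/-- The same with the hypothesis packaged as the `X`-order of the reduction `P̄ ∈ 𝔽_p⟦X⟧`: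
`ord_X P̄ = k ⟹ layerLambda (P.map φ) = k ∧ supNorm (P.map φ) = 1`. [cite: PollackWeston2011MT, §3.1] -/
theorem layerLambda_map_eq_of_order (φ : ℤ_[p] →+* A) (hφ : ∀ x, ‖φ x‖ = ‖x‖) {P : ℤ_[p][X]}
    {k : ℕ} (hord : ((P.map (PadicInt.toZMod (p := p)) : (ZMod p)[X]) : PowerSeries (ZMod p)).order = k) :
    layerLambda (P.map φ) = k ∧ (P.map φ).supNorm = 1 := by
  rw [PowerSeries.order_eq_nat] at hord
  obtain ⟨hk, hlt⟩ := hord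
  refine layerLambda_map_eq_of_coeff φ hφ (fun j hj ↦ ?_) ?_
  · have := hlt j hj
    rwa [Polynomial.coeff_coe, coeff_map] at this
  · rwa [Polynomial.coeff_coe, coeff_map] at hk

end Integral

/-! ## §3. Reduction modulo `ω_n = (X+1)^{pⁿ} − 1` is truncation mod `p` -/

section Truncation

/-- **`(X + 1)^{pⁿ} − 1 = X^{pⁿ}` in characteristic `p`** (Frobenius): the reduction of
`ω_n = (1+T)^{pⁿ} − 1`. [cite: Washington1997, §7.1] -/
theorem X_add_one_pow_prime_pow_sub_one {R : Type*} [CommRing R] (p : ℕ) [Fact p.Prime] [CharP R p]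
    (n : ℕ) : ((X : R[X]) + 1) ^ p ^ n - 1 = X ^ p ^ n := by
  rw [add_pow_char_pow, one_pow, add_sub_cancel_right]

variable {R : Type*} [CommRing R]

/-- Reduction modulo the monic `X^N` does not change the coefficients of index `< N`. [folklore] -/
theorem coeff_modByMonic_X_pow_of_lt (P : R[X]) {N j : ℕ} (hj : j < N) :
    (P %ₘ X ^ N).coeff j = P.coeff j := by
  rw [modByMonic_eq_sub_mul_div P (X ^ N), coeff_sub, coeff_X_pow_mul', if_neg (by omega),
    sub_zero]

/-- If `ord_X P = k < N` then `ord_X (P mod X^N) = k` (as power series). [folklore] -/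
theorem order_coe_modByMonic_X_pow (P : R[X]) {N k : ℕ} (hk : ((P : PowerSeries R)).order = k)
    (hkN : k < N) : (((P %ₘ X ^ N : R[X])) : PowerSeries R).order = k := by
  rw [PowerSeries.order_eq_nat] at hk ⊢
  obtain ⟨hk0, hlt⟩ := hk
  refine ⟨?_, fun i hi ↦ ?_⟩
  · rwa [Polynomial.coeff_coe, coeff_modByMonic_X_pow_of_lt P hkN, ← Polynomial.coeff_coe]
  · rw [Polynomial.coeff_coe, coeff_modByMonic_X_pow_of_lt P (hi.trans hkN), ← Polynomial.coeff_coe]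
    exact hlt i hi

/-- A polynomial with `ord_X = k` (as a power series) is non-zero. [folklore] -/
theorem ne_zero_of_order_coe_eq (P : R[X]) {k : ℕ} (hk : ((P : PowerSeries R)).order = k) : P ≠ 0 := by
  rintro rfl
  rw [Polynomial.coe_zero, PowerSeries.order_zero] at hk
  exact ENat.top_ne_coe _ hk

end Truncation

/-! ## §4. The layer-`n` representative of a `p`-adic exponent -/

section Exponent

variable {p : ℕ} [hp : Fact p.Prime]

/-- **`(f mod pⁿ) = p^{v_p(f)} · e′` with `p ∤ e′`**, for `0 ≠ f ∈ ℤ_p` with `v_p(f) < n`, where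
`(f mod pⁿ)` is the canonical representative in `[0, pⁿ)` (Mathlib `ZMod.val ∘ PadicInt.toZModPow n`).
[folklore] -/
theorem val_toZModPow_eq_pow_mul {f : ℤ_[p]} (hf : f ≠ 0) {n : ℕ} (hn : f.valuation < n) :
    ∃ e' : ℕ, ¬ p ∣ e' ∧ (PadicInt.toZModPow n f).val = p ^ f.valuation * e' := by
  haveI : NeZero (p ^ n) := ⟨pow_ne_zero _ hp.out.ne_zero⟩
  set t := f.valuation with ht
  set u : ℤ_[p]ˣ := PadicInt.unitCoeff hf with hu
  have hfu : f = (p : ℤ_[p]) ^ t * u := by rw [mul_comm]; exact PadicInt.unitCoeff_spec hf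
  set w : ZMod (p ^ n) := PadicInt.toZModPow n (u : ℤ_[p]) with hw
  have hwu : IsUnit w := (Units.isUnit u).map _
  have hval : (PadicInt.toZModPow n f).val = (p ^ t * w.val) % p ^ n := by
    rw [hfu, map_mul, map_pow, map_natCast, ZMod.val_mul, ← Nat.cast_pow, ZMod.val_natCast,
      Nat.mod_eq_of_lt (Nat.pow_lt_pow_right hp.out.one_lt hn)]
  obtain ⟨d, hd⟩ := Nat.exists_eq_add_of_lt hn
  have hpn : p ^ n = p ^ t * p ^ (d + 1) := by rw [← pow_add, hd, add_assoc]
  refine ⟨w.val % p ^ (d + 1), fun hdvd ↦ ?_, ?_⟩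
  · -- `w` is a unit mod `pⁿ`, so `p ∤ w.val`, and `w.val % p^{d+1} ≡ w.val (mod p)`
    have hcop : Nat.Coprime w.val (p ^ n) := by
      obtain ⟨w', hw'⟩ := hwu
      rw [← hw']
      exact ZMod.val_coe_unit_coprime w'
    have hpw : ¬ p ∣ w.val := fun h ↦ by
      have := Nat.Coprime.coprime_dvd_left h (hcop.coprime_dvd_right (dvd_pow_self p (by omega)))
      exact hp.out.ne_one ((Nat.coprime_self p).mp this)
    apply hpw
    have h1 : p ∣ p ^ (d + 1) := dvd_pow_self p (Nat.succ_ne_zero d)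
    have := (Nat.dvd_mod_iff h1).mp hdvd
    exact this
  · rw [hval, show p ^ t * w.val % p ^ n = p ^ t * w.val % (p ^ t * p ^ (d + 1)) from by rw [← hpn],
      Nat.mul_mod_mul_left]

end Exponent

end Summit.BirchSwinnertonDyer.BirchSwinnertonDyer.Theorems.ResidualThetaLayer

end
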